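import Summits.Ventures.CertifiedManyBodySolver.Downfold.PhaseMapBranchRoads
import Summits.Ventures.CertifiedManyBodySolver.Downfold.PhaseMapGridResolution

/-!
# The structure gate and the decidability ceiling at the MATERIAL level (FINDING F26)

Venture CertifiedManyBodySolver, cell `pub/hubbard-downfold`, seat hubbard-downfold-score-1 (second scoring engine);
namespace `Summit.Ventures.CertifiedManyBodySolver.Downfold.CellScore`. Context: score-1's DECIDABILITY CEILING (FINDING F22,
`PhaseMapDifferentiation.unreachable_of_ceiling_fails`): per floored class, the most members that can be decided WHILE THE ROUTER WORDS
STAND = members − «UND-blocked» members; the director and the downfold lead cite it for word choices. What governs a COLUMN of a map is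
the router head at that P (ACCEPTANCE v1.9 item 9 / FORMAT by_P); by ACCEPTANCE §3.3 R-2W + the assembler precedence FORMAT l.53 the
heads fall in three classes:

* a BRANCH head (EPH / 1BH / 3BE / BI / CI, with or without the insulator default): any stage hand-in is admissible — a band, a box word,
  an SC or a «not» cell;
* the STRUCTURE GATE (UND:STRUCT / UND:DISPUTED: structure of no record or disputed at that P): cells read «undetermined (structure)»;
  the ONLY admissible hand-in is a certified ENVELOPE «not» covering every candidate structure (§3.3 (c) v1.3 envelope exception) —
  never «SC», never a band;
* a ROUTER-BLOCKED head (UND:MIXED / UND:FLAT / UND:MULTIORB / UND:HF): cells read «undetermined (router:UND:…)», nothing is admissible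
  (W9; a band under it is fenced, v1.9 item 7).

Until 2026-08-27T12:22Z score-1's tool counted a material BLOCKED iff EVERY undetermined cell read router:UND (a cell rule). RUN 27al/27an
(M220 TaS₂-2H, M221 TaSe₂-2H: «UND:MIXED+EPH» @0 beside «UND:STRUCT+UND:MIXED+EPH» @P) showed the rule is optimistic: such a material can
reach NEITHER verdict — NOT needs «not» at every relevant cell (impossible on the router column), SC needs an SC-capable column (the gate
admits «not» only). This file is the KERNEL FORM of the corrected, material-level rule. Everything is PROVED.

WHAT THIS IS NOT: not an ACCEPTANCE rule and not a number of record (the ceiling is score-1's informational diagnostic; no parity or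
tally depends on it); not a statement about which word is right (the router pen's).

* §1 `Gov` (branch ∣ gate ∣ router), `admit` = what a column's cells may read given a hand-in (`admit_gate_ne_SC`, `admit_router`),
  `Col` = (governing class, temperature grid, per-cell hand-in, optional band), `Col.cells` / `Col.bands` (a band rides only on a branch
  column), `cellsOf` / `bandsOf` over a material's columns; membership lemmas; `cellsOf_ne_SC_of_no_branch`, `bandsOf_eq_nil_of_no_branch`.
* §2 THE F26 THEOREM `verdict_blocked`: a material with NO branch column and ONE router-blocked column carrying a cell at/above the floor
  has verdict UNDETERMINED for EVERY choice of hand-ins and bands ⇒ `kind_blocked` = ABSTAIN for either truth class (it can count toward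
  no decided-fraction floor while the words stand). The two escape routes, constructively: `verdict_SC_of_branch_SC` (one branch column
  with an SC hand-in at any cell ⇒ SC) and `verdict_NOT_of_envelopes` (no router column, «not» handed in everywhere — envelopes on the gate
  columns, words/defaults on branch columns —, no band, one relevant cell ⇒ NOT): so «router ∈ heads ∧ heads ⊆ {router, gate}» is exactly
  the blocked shape, and an all-gate material is NOT blocked (`gate_only_decides_NOT`).
* §3 numbers of record (run-2026-08-27an): `m220_blocked` (router column @0 + gate column @9.5 over T22, floor 1/10 K ⇒ ABSTAIN whatever is
  handed in), `v8_conventional_ceiling` (13 non-exempt members, floor 0.9 ⇒ need 12; M220 and M221 blocked ⇒ ceiling 11 < 12: UNREACHABLE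
  while the @0 words stand; the cell rule had said 13/13), `v3_v7_ceilings` (M86 Zr ⇒ conventional 24/29 vs need 27; M202 PtH ⇒ hydride
  1/3 vs need 3 — unreachable before and after).
-/

namespace Summit.Ventures.CertifiedManyBodySolver.Downfold

namespace CellScore

/-! ## §1 Governing classes, admissible hand-ins, columns -/

/-- The three classes of governing router head of a column (ACCEPTANCE §3.3 R-2W + FORMAT l.53): a branch word; the structure gate
(UND:STRUCT / UND:DISPUTED); a router-blocked UND tag (UND:MIXED / UND:FLAT / UND:MULTIORB / UND:HF). [folklore] -/
inductive Gov
  | branch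
  | gate
  | router
  deriving DecidableEq, Repr

/-- What a cell of a column governed by `g` reads when the stages hand in the word `w` for it: a branch column takes the hand-in as is;
the structure gate admits only «not» (the §3.3 (c) certified-envelope exception) — any other hand-in leaves the cell undetermined; a
router-blocked column reads undetermined whatever is handed in. [folklore] -/
def admit : Gov → Word → Word
  | .branch, w => w
  | .gate, w => if w = Word.not then Word.not else Word.undetermined
  | .router, _ => Word.undetermined

/-- A router-blocked column reads «undetermined» whatever is handed in. [folklore] -/
@[simp] theorem admit_router (w : Word) : admit .router w = Word.undetermined := rfl

/-- A branch column reads the hand-in. [folklore] -/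
@[simp] theorem admit_branch (w : Word) : admit .branch w = w := rfl

/-- The structure gate admits the envelope «not». [folklore] -/
@[simp] theorem admit_gate_not : admit .gate Word.not = Word.not := rfl

/-- The structure gate never lets a cell read «SC». [folklore] -/
theorem admit_gate_ne_SC (w : Word) : admit .gate w ≠ Word.SC := by
  cases w <;> decide

/-- Only a branch column can ever read «SC». [folklore] -/
theorem admit_eq_SC {g : Gov} {w : Word} (h : admit g w = Word.SC) : g = .branch := by
  cases g
  · rfl
  · exact absurd h (admit_gate_ne_SC w)
  · exact absurd h (by simp)

/-- One column of a map as the §4.5 verdict sees it: its governing class, its temperature grid, the stages' hand-in per cell, and an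
optional T_c band (lo, hi). [folklore] -/
structure Col where
  /-- governing class of the router head at this P -/
  gov : Gov
  /-- temperature grid of the column (T22 on every map of record) -/
  Ts : List ℚ
  /-- the stages' hand-in per cell (what S2 / e–ph / a default would write there) -/
  hand : ℚ → Word
  /-- an e–ph T_c band handed in for this column, if any -/
  band : Option (ℚ × ℚ)

/-- The cells of a column: each grid temperature with the ADMITTED word. [folklore] -/
def Col.cells (c : Col) : List (ℚ × Word) :=
  c.Ts.map (fun T => (T, admit c.gov (c.hand T)))

/-- The band a column contributes to the verdict: a band rides only on a branch column (the assembler attaches a band only under an EPH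
head; under an UND head it is fenced — v1.9 item 7 / F23). [folklore] -/
def Col.bands (c : Col) : List (ℚ × ℚ) :=
  if c.gov = .branch then c.band.toList else []

/-- All cells of a material (its columns' cells appended; the §4.5 verdict reads every column above one floor). [folklore] -/
def cellsOf : List Col → List (ℚ × Word)
  | [] => []
  | c :: cs => c.cells ++ cellsOf cs

/-- All bands of a material. [folklore] -/
def bandsOf : List Col → List (ℚ × ℚ)
  | [] => []
  | c :: cs => c.bands ++ bandsOf cs

/-- Membership in a material's cells: the cell comes from some column. [folklore] -/
theorem mem_cellsOf {cs : List Col} {x : ℚ × Word} : x ∈ cellsOf cs ↔ ∃ c ∈ cs, x ∈ c.cells := by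
  induction cs with
  | nil => simp [cellsOf]
  | cons c cs ih =>
    simp only [cellsOf, List.mem_append, ih, List.mem_cons]
    constructor
    · rintro (h | ⟨c', hc', hx⟩)
      · exact ⟨c, Or.inl rfl, h⟩
      · exact ⟨c', Or.inr hc', hx⟩
    · rintro ⟨c', (rfl | hc'), hx⟩
      · exact Or.inl hx
      · exact Or.inr ⟨c', hc', hx⟩

/-- Membership in a material's bands: the band rides on some column. [folklore] -/
theorem mem_bandsOf {cs : List Col} {b : ℚ × ℚ} : b ∈ bandsOf cs ↔ ∃ c ∈ cs, b ∈ c.bands := by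
  induction cs with
  | nil => simp [bandsOf]
  | cons c cs ih =>
    simp only [bandsOf, List.mem_append, ih, List.mem_cons]
    constructor
    · rintro (h | ⟨c', hc', hx⟩)
      · exact ⟨c, Or.inl rfl, h⟩
      · exact ⟨c', Or.inr hc', hx⟩
    · rintro ⟨c', (rfl | hc'), hx⟩
      · exact Or.inl hx
      · exact Or.inr ⟨c', hc', hx⟩

/-- Membership in one column's cells. [folklore] -/
theorem Col.mem_cells {c : Col} {x : ℚ × Word} : x ∈ c.cells ↔ ∃ T ∈ c.Ts, (T, admit c.gov (c.hand T)) = x := by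
  simp [Col.cells, List.mem_map]

/-- A non-branch column contributes no band. [folklore] -/
theorem Col.bands_of_ne_branch {c : Col} (h : c.gov ≠ .branch) : c.bands = [] := by
  simp [Col.bands, h]

/-- A material with no branch column has no SC cell, whatever is handed in. [folklore] -/
theorem cellsOf_ne_SC_of_no_branch {cs : List Col} (h : ∀ c ∈ cs, c.gov ≠ .branch) :
    ∀ x ∈ cellsOf cs, x.2 ≠ Word.SC := by
  intro x hx hSC
  obtain ⟨c, hc, hxc⟩ := mem_cellsOf.mp hx
  obtain ⟨T, _, rfl⟩ := Col.mem_cells.mp hxc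
  exact h c hc (admit_eq_SC hSC)

/-- … and no band. [folklore] -/
theorem bandsOf_eq_nil_of_no_branch {cs : List Col} (h : ∀ c ∈ cs, c.gov ≠ .branch) : bandsOf cs = [] := by
  rw [List.eq_nil_iff_forall_not_mem]
  intro b hb
  obtain ⟨c, hc, hbc⟩ := mem_bandsOf.mp hb
  rw [Col.bands_of_ne_branch (h c hc)] at hbc
  simp at hbc

/-! ## §2 The F26 theorem and the two escape routes -/

/-- THE F26 THEOREM: a material with NO branch column and a ROUTER-BLOCKED column carrying a cell at or above the floor has verdict
UNDETERMINED for every choice of hand-ins and bands — nothing S2, hubbard-eph or a default can hand in decides it while the words stand.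
(Proof: no SC cell and no band without a branch column; the router cell at/above the floor reads «undetermined», so «NOT» — «not» at
every relevant cell — fails too.) [folklore] -/
theorem verdict_blocked (Tfloor : ℚ) (cs : List Col) (hnb : ∀ c ∈ cs, c.gov ≠ .branch)
    (hr : ∃ c ∈ cs, c.gov = .router ∧ ∃ T ∈ c.Ts, Tfloor ≤ T) :
    verdict Tfloor (cellsOf cs) (bandsOf cs) = .UNDETERMINED := by
  rw [bandsOf_eq_nil_of_no_branch hnb]
  refine verdict_undetermined_of_relevant_undetermined Tfloor _ (cellsOf_ne_SC_of_no_branch hnb) ?_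
  obtain ⟨c, hc, hg, T, hT, hle⟩ := hr
  refine ⟨(T, Word.undetermined), ?_, hle, rfl⟩
  rw [mem_cellsOf]
  refine ⟨c, hc, ?_⟩
  rw [Col.mem_cells]
  exact ⟨T, hT, by rw [hg, admit_router]⟩

/-- … hence its confusion entry is ABSTAIN for EITHER truth class: the material counts toward no decided-fraction floor while the words
stand — it is UND-BLOCKED for the decidability ceiling. [folklore] -/
theorem kind_blocked (Tfloor : ℚ) (cs : List Col) (hnb : ∀ c ∈ cs, c.gov ≠ .branch)
    (hr : ∃ c ∈ cs, c.gov = .router ∧ ∃ T ∈ c.Ts, Tfloor ≤ T) (isSC : Bool) :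
    kind (verdict Tfloor (cellsOf cs) (bandsOf cs)) isSC = .ABSTAIN := by
  rw [verdict_blocked Tfloor cs hnb hr]; cases isSC <;> rfl

/-- ESCAPE ROUTE (a): one branch column whose hand-in reads «SC» at some grid temperature ⇒ verdict SC (TP on a superconductor, FP
otherwise) — a router-blocked column elsewhere does not prevent it. [folklore] -/
theorem verdict_SC_of_branch_SC (Tfloor : ℚ) (cs : List Col) {c : Col} (hc : c ∈ cs) (hg : c.gov = .branch)
    {T : ℚ} (hT : T ∈ c.Ts) (hw : c.hand T = Word.SC) :
    verdict Tfloor (cellsOf cs) (bandsOf cs) = .SC := by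
  rw [verdict_eq_SC_iff, saysSC_eq_true_iff]
  refine Or.inl ⟨(T, Word.SC), ?_, rfl⟩
  rw [mem_cellsOf]
  refine ⟨c, hc, ?_⟩
  rw [Col.mem_cells]
  exact ⟨T, hT, by rw [hg, admit_branch, hw]⟩

/-- ESCAPE ROUTE (a'): one branch column carrying a band with lo ≥ 1/10 K ⇒ verdict SC. [folklore] -/
theorem verdict_SC_of_branch_band (Tfloor : ℚ) (cs : List Col) {c : Col} (hc : c ∈ cs) (hg : c.gov = .branch)
    {lo hi : ℚ} (hb : c.band = some (lo, hi)) (hlo : (1 : ℚ) / 10 ≤ lo) :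
    verdict Tfloor (cellsOf cs) (bandsOf cs) = .SC := by
  rw [verdict_eq_SC_iff, saysSC_eq_true_iff]
  refine Or.inr ⟨(lo, hi), ?_, hlo⟩
  rw [mem_bandsOf]
  exact ⟨c, hc, by simp [Col.bands, hg, hb]⟩

/-- ESCAPE ROUTE (b): NO router-blocked column, «not» handed in at every cell (certified envelopes on the gate columns, words / defaults /
band-above on the branch columns), no band, and at least one cell at/above the floor ⇒ verdict NOT (TN on a non-superconductor, FN on a
superconductor). So the structure gate alone never blocks a material. [folklore] -/
theorem verdict_NOT_of_envelopes (Tfloor : ℚ) (cs : List Col) (hnr : ∀ c ∈ cs, c.gov ≠ .router)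
    (hnot : ∀ c ∈ cs, ∀ T ∈ c.Ts, c.hand T = Word.not) (hband : ∀ c ∈ cs, c.band = none)
    (hrel : ∃ c ∈ cs, ∃ T ∈ c.Ts, Tfloor ≤ T) :
    verdict Tfloor (cellsOf cs) (bandsOf cs) = .NOT := by
  -- every cell reads «not»
  have hall : ∀ x ∈ cellsOf cs, x.2 = Word.not := by
    intro x hx
    obtain ⟨c, hc, hxc⟩ := mem_cellsOf.mp hx
    obtain ⟨T, hT, rfl⟩ := Col.mem_cells.mp hxc
    have hw := hnot c hc T hT
    have hg := hnr c hc
    revert hg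
    cases hgc : c.gov <;> intro hg
    · simp [admit, hw]
    · simp [admit, hw]
    · exact absurd rfl hg
  -- no band at all
  have hbands : bandsOf cs = [] := by
    rw [List.eq_nil_iff_forall_not_mem]
    intro b hb
    obtain ⟨c, hc, hbc⟩ := mem_bandsOf.mp hb
    simp [Col.bands, hband c hc] at hbc
  rw [hbands]
  unfold verdict
  have h1 : saysSC (cellsOf cs) [] = false := by
    rw [Bool.eq_false_iff, Ne, saysSC_eq_true_iff]
    rintro (⟨x, hxm, hxw⟩ | ⟨b, hbm, _⟩)
    · rw [hall x hxm] at hxw; exact Word.noConfusion hxw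
    · simp at hbm
  have h2 : saysNOT Tfloor (cellsOf cs) [] = true := by
    obtain ⟨c, hc, T, hT, hle⟩ := hrel
    have hmem : (T, admit c.gov (c.hand T)) ∈ cellsOf cs := mem_cellsOf.mpr ⟨c, hc, Col.mem_cells.mpr ⟨T, hT, rfl⟩⟩
    simp only [saysNOT, relevant, Bool.and_eq_true, Bool.not_eq_true', List.all_eq_true, decide_eq_true_eq, List.any_nil,
               List.isEmpty_eq_false_iff_exists_mem, List.mem_filter]
    refine ⟨⟨⟨(T, admit c.gov (c.hand T)), hmem, by simpa using hle⟩, ?_⟩, trivial⟩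
    rintro x ⟨hx, _⟩
    exact hall x hx
  simp [h1, h2]

/-- Corollary: a material whose every column is the structure gate, with envelopes handed in everywhere and a relevant cell, is DECIDED
(NOT) — the gate alone is reachable; only a router-blocked column beside it blocks (`verdict_blocked`). [folklore] -/
theorem gate_only_decides_NOT (Tfloor : ℚ) (cs : List Col) (hg : ∀ c ∈ cs, c.gov = .gate)
    (hnot : ∀ c ∈ cs, ∀ T ∈ c.Ts, c.hand T = Word.not) (hband : ∀ c ∈ cs, c.band = none)
    (hrel : ∃ c ∈ cs, ∃ T ∈ c.Ts, Tfloor ≤ T) :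
    verdict Tfloor (cellsOf cs) (bandsOf cs) = .NOT :=
  verdict_NOT_of_envelopes Tfloor cs (fun c hc => by rw [hg c hc]; decide) hnot hband hrel

/-! ## §3 Numbers of record (run-2026-08-27an, 2026-08-27T12:22Z) -/

/-- M220 TaS₂-2H (v8, conventional, known-SC; floor 1/10 K): column @0 «UND:MIXED+EPH» = router-blocked, column @9.5 «UND:STRUCT+…» =
structure gate, both over the T22 grid. WHATEVER is handed in (any words, any bands): ABSTAIN. M221 TaSe₂-2H (@0 / @23), M86 Zr (v3;
@0 / @30) and M202 PtH (v7) have the same shape. [folklore] -/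
theorem m220_blocked (h0 h95 : ℚ → Word) (b0 b95 : Option (ℚ × ℚ)) (isSC : Bool) :
    kind (verdict (1 / 10) (cellsOf [⟨.router, T22, h0, b0⟩, ⟨.gate, T22, h95, b95⟩])
      (bandsOf [⟨.router, T22, h0, b0⟩, ⟨.gate, T22, h95, b95⟩])) isSC = .ABSTAIN := by
  refine kind_blocked (1 / 10) _ ?_ ?_ isSC
  · intro c hc
    simp only [List.mem_cons, List.mem_nil_iff, or_false] at hc
    rcases hc with rfl | rfl <;> intro h <;> cases h
  · refine ⟨⟨.router, T22, h0, b0⟩, by simp, rfl, 300, ?_, by norm_num⟩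
    simp [T22]

/-- Contrast: had BOTH columns been the structure gate (a located-structure question only), certified envelopes «not» on both would
decide the material (NOT ⇒ FN here, since TaS₂ superconducts — the point is decidability, not the outcome). [folklore] -/
theorem m220_gate_only_would_decide :
    verdict (1 / 10) (cellsOf [⟨.gate, T22, fun _ => Word.not, none⟩, ⟨.gate, T22, fun _ => Word.not, none⟩])
      (bandsOf [⟨.gate, T22, fun _ => Word.not, none⟩, ⟨.gate, T22, fun _ => Word.not, none⟩]) = .NOT := by
  refine gate_only_decides_NOT (1 / 10) _ ?_ ?_ ?_ ?_
  · intro c hc; simp only [List.mem_cons, List.mem_nil_iff, or_false] at hc; rcases hc with rfl | rfl <;> rfl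
  · intro c hc T _; simp only [List.mem_cons, List.mem_nil_iff, or_false] at hc; rcases hc with rfl | rfl <;> rfl
  · intro c hc; simp only [List.mem_cons, List.mem_nil_iff, or_false] at hc; rcases hc with rfl | rfl <;> rfl
  · exact ⟨⟨.gate, T22, fun _ => Word.not, none⟩, by simp, 300, by simp [T22], by norm_num⟩

/-- v8 conventional class on run-2026-08-27an: 13 non-exempt members, floor 0.9 ⇒ 12 needed (9·13 = 117 ≤ 10·12 = 120, while 10·11 = 110 <
117); M220 and M221 blocked ⇒ ceiling 13 − 2 = 11 < 12: the clause is UNREACHABLE while the two @0 words stand (the cell rule had printed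
13/13 reachable). [folklore] -/
theorem v8_conventional_ceiling :
    (9 : ℕ) * 13 ≤ 10 * 12 ∧ ¬ ((9 : ℕ) * 13 ≤ 10 * 11) ∧ (13 : ℕ) - 2 = 11 ∧ (11 : ℕ) < 12 := by
  refine ⟨by norm_num, by norm_num, rfl, by norm_num⟩

/-- v3 conventional (M86 Zr newly blocked): 29 members, floor 0.9 ⇒ need 27 (9·29 = 261 ≤ 270, 260 < 261); blocked 4 → 5 ⇒ ceiling 25 → 24,
unreachable either way. v7 hydride (M202 PtH newly blocked): 3 members, need 3; blocked 1 → 2 ⇒ ceiling 2 → 1, unreachable either way.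
[folklore] -/
theorem v3_v7_ceilings :
    ((9 : ℕ) * 29 ≤ 10 * 27 ∧ ¬ ((9 : ℕ) * 29 ≤ 10 * 26) ∧ (29 : ℕ) - 5 = 24 ∧ (24 : ℕ) < 27 ∧ (25 : ℕ) < 27) ∧
      ((9 : ℕ) * 3 ≤ 10 * 3 ∧ ¬ ((9 : ℕ) * 3 ≤ 10 * 2) ∧ (3 : ℕ) - 2 = 1 ∧ (1 : ℕ) < 3 ∧ (2 : ℕ) < 3) := by
  refine ⟨⟨by norm_num, by norm_num, rfl, by norm_num, by norm_num⟩, ⟨by norm_num, by norm_num, rfl, by norm_num, by norm_num⟩⟩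

/-! ## §4 APPEND (g11, 2026-08-27T13:2xZ) — e–ph hand-in shapes on a branch column: what a T_c band decides (WORKLIST rules; O-g11-7)

The work list score-1 prints per undecided material (tools/worklist.py) states, for an EPH-governed column, WHICH band decides the material WHICH
way. These are the §4.5 clauses of `PhaseMapMaterialVerdict` read on one band: a band with lo ≥ 1/10 K says SC (TP on a superconductor, FP on a
control); verdict NOT additionally requires NO band with hi ≥ 1/10 K — so a «T_c < hi» band decides a control TN only when hi < 1/10 K
(observation O-g11-7 to the acceptance pen: a band that clears only the MEASURED range, hi < T_floor but ≥ 1/10 K, leaves the material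
UNDETERMINED although every measured cell reads «not»). Everything is PROVED; the text decides whether that is intended. -/

/-- The cells an e–ph «T_c < hi» band [0, hi] writes on a column over the grid `Ts`: «not» above hi, «undetermined» at or below it (lo = 0: no cell
lies below lo). [folklore] -/
def zeroBandCells (hi : ℚ) (Ts : List ℚ) : List (ℚ × Word) :=
  Ts.map (fun T => (T, if hi < T then Word.not else Word.undetermined))

/-- No cell of a «T_c < hi» column reads «SC». [folklore] -/
theorem zeroBandCells_ne_SC (hi : ℚ) (Ts : List ℚ) : ∀ c ∈ zeroBandCells hi Ts, c.2 ≠ Word.SC := by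
  intro c hc
  simp only [zeroBandCells, List.mem_map] at hc
  obtain ⟨T, _, rfl⟩ := hc
  dsimp only
  split_ifs <;> decide

/-- O-g11-7, THE CLAUSE: whatever the cells, a band with hi ≥ 1/10 K forbids verdict NOT (ACCEPTANCE §4.5 «… and no band with hi ≥ 0.1 K»). [folklore] -/
theorem verdict_ne_NOT_of_band_hi (Tfloor : ℚ) (cells : List (ℚ × Word)) (bands : List (ℚ × ℚ))
    (h : ∃ b ∈ bands, (1 : ℚ) / 10 ≤ b.2) : verdict Tfloor cells bands ≠ .NOT := by
  obtain ⟨b, hb, hle⟩ := h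
  have hnot : saysNOT Tfloor cells bands = false := by
    rw [Bool.eq_false_iff]
    intro hs
    simp only [saysNOT, Bool.and_eq_true, Bool.not_eq_true'] at hs
    have h3 : (bands.any fun b => decide ((1 : ℚ) / 10 ≤ b.2)) = true :=
      List.any_eq_true.mpr ⟨b, hb, (by simpa using hle : decide ((1 : ℚ) / 10 ≤ b.2) = true)⟩
    rw [hs.2] at h3
    exact Bool.false_ne_true h3
  unfold verdict
  rw [hnot]
  split_ifs <;> first | contradiction | simp

/-- … so a «T_c < hi» band that clears only the MEASURED range is not a TN: control measured down to T_floor = 2 K, band [0, 1] (every cell at T ≥ 2 K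
reads «not»), verdict UNDETERMINED ⇒ ABSTAIN (T22 grid). [folklore] -/
theorem band_clearing_measured_range_abstains :
    kind (verdict 2 (zeroBandCells 1 T22) [(0, 1)]) false = .ABSTAIN := by
  have hne : verdict 2 (zeroBandCells 1 T22) [(0, 1)] ≠ .NOT :=
    verdict_ne_NOT_of_band_hi 2 _ _ ⟨(0, 1), by simp, by norm_num⟩
  have hns : verdict 2 (zeroBandCells 1 T22) [(0, 1)] ≠ .SC :=
    verdict_ne_SC_of_noSC (zeroBandCells_ne_SC 1 T22) (by intro b hb; simp at hb; subst hb; norm_num)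
  revert hne hns
  cases verdict 2 (zeroBandCells 1 T22) [(0, 1)] <;> simp [kind]

/-- THE TN SHAPE: a «T_c < hi» band with hi < 1/10 K on the only column of a control (every grid point ≥ T_floor then lies above hi and reads «not»;
T22 has such points for any floor ≤ 400 K) ⇒ verdict NOT ⇒ TN — M32 Cu [0, 1.4·10⁻¹⁵] and M52a Au [0, 3.8·10⁻⁴] are decided exactly so. Here: floor
1/10 K, hi = 1/20 K. [folklore] -/
theorem zero_band_below_tenth_TN :
    kind (verdict (1 / 10) (zeroBandCells (1 / 20) T22) [(0, 1 / 20)]) false = .TN := by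
  have hSC : saysSC (zeroBandCells (1 / 20) T22) [(0, 1 / 20)] = false := by
    rw [Bool.eq_false_iff, Ne, saysSC_eq_true_iff]
    rintro (⟨c, hcm, hcw⟩ | ⟨b, hbm, hbl⟩)
    · exact zeroBandCells_ne_SC _ _ c hcm hcw
    · simp at hbm; subst hbm; norm_num at hbl
  have hNOT : saysNOT (1 / 10) (zeroBandCells (1 / 20) T22) [(0, 1 / 20)] = true := by
    simp only [saysNOT, relevant, zeroBandCells, T22, Bool.and_eq_true, Bool.not_eq_true', List.all_eq_true, decide_eq_true_eq,
               List.isEmpty_eq_false_iff_exists_mem, List.mem_filter, List.mem_map, List.any_cons, List.any_nil, Bool.or_false, decide_eq_false_iff_not]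
    refine ⟨⟨⟨(300, Word.not), ⟨⟨300, by norm_num, by norm_num⟩, by norm_num⟩⟩, ?_⟩, by norm_num⟩
    rintro c ⟨⟨T, hT, rfl⟩, hle⟩
    have hle' : (1 : ℚ) / 10 ≤ T := by simpa using hle
    have h20 : (1 : ℚ) / 20 < T := by linarith
    have h20' : (20 : ℚ)⁻¹ < T := by norm_num at h20 ⊢; linarith
    simp [h20']
  unfold verdict
  rw [hSC, hNOT]
  simp [kind]

/-- THE TP SHAPE: on a superconductor a band with lo ≥ 1/10 K on a branch column says SC by the band clause ⇒ TP, whatever the other columns read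
(`verdict_SC_of_branch_band`); the same band on a control is an FP. [folklore] -/
theorem band_clause_TP_or_FP (Tfloor : ℚ) (cs : List Col) {c : Col} (hc : c ∈ cs) (hg : c.gov = .branch)
    {lo hi : ℚ} (hb : c.band = some (lo, hi)) (hlo : (1 : ℚ) / 10 ≤ lo) (isSC : Bool) :
    kind (verdict Tfloor (cellsOf cs) (bandsOf cs)) isSC = (if isSC then .TP else .FP) := by
  rw [verdict_SC_of_branch_band Tfloor cs hc hg hb hlo]; cases isSC <;> rfl

end CellScore

end Summit.Ventures.CertifiedManyBodySolver.Downfold
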